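import Literature.MathematicalPhysics.QuantumManyBody.PeriodicBoseGasUpperBoundProofs
import HarnessLib

/-!
# Route `BECRichardsonGaudin`, crux `BeliaevDeformationBound` (stmt-AtomisticToContinuum-14804):
# stub B1c — a condensed near-optimal periodic trial state

Worker file for the line `registered` (`Cruxes/BeliaevDeformationBound/Lines/birth.lean`, skeleton
v2), supporting (not closing) stmt-AtomisticToContinuum-14804.

`stub_condensedTrialState`: from the depletion bound (B1a) and the energy bound (B1b) of the
symmetric Jastrow state `Ψ_J = ∏_{i<j} φ(xᵢ - xⱼ)/‖·‖` (`IsPairProfile.trialState`), taken as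
hypotheses, for every soft repulsive finite-range `v` (`∫ v(|x|) dx < ∞`) and every `η > 0`, at all
small `ρ` and for every `N = n + 2`, the torus of side `L = (N/ρ)^{1/3}` carries a periodic trial
state with energy `≤ 4πaρ(1+η)N` and condensate `n₀ ≥ N - ηN` (`a` the scattering length).
This is the parameter bookkeeping (2.32)–(2.33) of the proof of [LSSY2005, Thm. 2.2], exactly as in
`LSSY2005_upperBound_periodic_of_layers`: for `a = 0` the constant profile
(`LSSY2005_zeroScatteringLength_holds`: `v = 0` a.e., so `E₁ = I = K = 0`); for `a > 0` the
profile of App. C (`LSSY2005_dysonProfile_holds`) with `b = (4πρ₁/3)^{-1/3}`, `ρ₁ = (N-1)/L³ ≤ ρ`,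
cut off at `b/4 ≥ b₀(v)`, `x = a/b ≤ min(1/16, η/30)` for `ρ < ρ₀(v, η)`, so that
`(N-1)I/L³ = 3x/4` (depletion `≤ 2 · 3x/4 ≤ η`) and, by `jastrow_optimisation`,
`⟨Ψ_J, HΨ_J⟩ ≤ 4πρ₁a(1+12x)N + (slack) ≤ 4πaρ(1+η)N`.

References: [LSSY2005] E. H. Lieb, R. Seiringer, J. P. Solovej, J. Yngvason, *The Mathematics of
the Bose Gas and its Condensation*, Oberwolfach Seminars 34, Birkhäuser 2005,
arXiv:cond-mat/0610117: Thm. 2.2 (2.14), proof (2.15)–(2.33); App. C, Thm. C.1 (C.8).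
-/

noncomputable section

namespace Summit.AtomisticToContinuum.BoseEinsteinCondensation.Theorems.BeliaevDeformationBound

open scoped ENNReal
open MeasureTheory Filter
open Literature.MathematicalPhysics.QuantumManyBody.BoseGas

/-- `N ≤ n₀ + ηN` in `ℝ≥0∞` as soon as `N(1-t)² ≤ n₀` with `2t ≤ η`
(because `1 - (1-t)² ≤ 2t`). [cite: LSSY2005, Thm. 2.2, proof, (2.26)] -/
theorem condensedTrialState_natCast_le {N : ℕ} {t η : ℝ} {x : ℝ≥0∞} (ht : 2 * t ≤ η)
    (h : (N : ℝ≥0∞) * ENNReal.ofReal ((1 - t) ^ 2) ≤ x) :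
    (N : ℝ≥0∞) ≤ x + ENNReal.ofReal (η * N) := by
  have hN : (0 : ℝ) ≤ N := N.cast_nonneg
  have hreal : (N : ℝ) ≤ N * (1 - t) ^ 2 + η * N := by
    nlinarith [mul_nonneg hN (sq_nonneg t), mul_nonneg hN (sub_nonneg.mpr ht)]
  calc (N : ℝ≥0∞) = ENNReal.ofReal (N : ℝ) := (ENNReal.ofReal_natCast N).symm
    _ ≤ ENNReal.ofReal (N * (1 - t) ^ 2 + η * N) := ENNReal.ofReal_le_ofReal hreal
    _ ≤ ENNReal.ofReal (N * (1 - t) ^ 2) + ENNReal.ofReal (η * N) := ENNReal.ofReal_add_le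
    _ = (N : ℝ≥0∞) * ENNReal.ofReal ((1 - t) ^ 2) + ENNReal.ofReal (η * N) := by
        rw [ENNReal.ofReal_mul hN, ENNReal.ofReal_natCast]
    _ ≤ x + ENNReal.ofReal (η * N) := add_le_add h le_rfl

/-- The optimisation (2.32)–(2.33) with a slack: for `4π(N-1)b³ = 3L³` (`b = (4πρ₁/3)^{-1/3}`,
`ρ₁ = (N-1)/L³ ≤ ρ`), cut-off `b/4`, `x = a/b ≤ 1/16` with `12x ≤ η/2`, and a profile-energy
slack `ε'` contributing at most `4πaρ(η/2)N`, the Jastrow bound is `≤ 4πaρ(1+η)N`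
(`jastrow_optimisation`: the slack-free part is `≤ 4πρ₁a(1+12x)N`).
[cite: LSSY2005, Thm. 2.2, proof, (2.32)–(2.33)] -/
theorem condensedTrialState_energy_le {N L a b ρ η ε' : ℝ} (hN : 2 ≤ N) (ha : 0 < a)
    (hb : 0 < b) (hx : a / b ≤ 1 / 16) (hxη : 12 * (a / b) ≤ η / 2)
    (hb3 : 4 * Real.pi * (N - 1) * b ^ 3 = 3 * L ^ 3) (hρ : 0 ≤ ρ) (hρ₁ : (N - 1) / L ^ 3 ≤ ρ)
    (hε' : N * (N - 1) / 2 * ε' / (L ^ 3 - (N - 1) * (16 * Real.pi * a * (b / 4) ^ 2)) ≤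
      4 * Real.pi * a * ρ * (η / 2) * N) :
    N * (N - 1) / 2 * (8 * Real.pi * a / (1 - a / (b / 4)) + ε') /
          (L ^ 3 - (N - 1) * (16 * Real.pi * a * (b / 4) ^ 2)) +
        N * (N - 1) * (N - 2) * (16 * Real.pi * a * (b / 4)) ^ 2 /
          (L ^ 3 - (N - 1) * (16 * Real.pi * a * (b / 4) ^ 2)) ^ 2 ≤
      4 * Real.pi * a * ρ * (1 + η) * N := by
  have key := jastrow_optimisation hN ha hb hx hb3
  have hsplit : N * (N - 1) / 2 * (8 * Real.pi * a / (1 - a / (b / 4)) + ε') /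
        (L ^ 3 - (N - 1) * (16 * Real.pi * a * (b / 4) ^ 2)) =
      N * (N - 1) / 2 * (8 * Real.pi * a / (1 - a / (b / 4))) /
          (L ^ 3 - (N - 1) * (16 * Real.pi * a * (b / 4) ^ 2)) +
        N * (N - 1) / 2 * ε' / (L ^ 3 - (N - 1) * (16 * Real.pi * a * (b / 4) ^ 2)) := by
    rw [mul_add, add_div]
  have hA0 : 0 ≤ 4 * Real.pi * a * N := by positivity
  have step : (N - 1) / L ^ 3 * (1 + 12 * (a / b)) ≤ ρ * (1 + η / 2) :=
    mul_le_mul hρ₁ (by linarith) (by positivity) hρ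
  have step' := mul_le_mul_of_nonneg_left step hA0
  rw [hsplit]
  linarith

/-- The case `a = 0` (`v = 0` a.e.): the Jastrow state of the constant profile `φ ≡ 1` (cut-off
`L/4`, `E = I = K = 0`) has energy `0` and is completely condensed, by the two Jastrow bounds taken
as hypotheses. [cite: LSSY2005, Thm. 2.2, proof, (2.26)–(2.33); App. C (C.8)] -/
theorem condensedTrialState_of_zero
    (hJD : ∀ (N : ℕ) (L b : ℝ) (φ : Space → ℝ) (hφ : IsPairProfile b φ) (hL : 0 < L)
      (hbL : 2 * b < L) (hν : 0 < jastrowNormR L φ (Finset.univ : Finset (Fin N))) (I : ℝ),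
      0 ≤ I → profileDefect φ ≤ ENNReal.ofReal I → ((N : ℝ) - 1) * I ≤ L ^ 3 →
      (N : ENNReal) * ENNReal.ofReal ((1 - ((N : ℝ) - 1) * I / L ^ 3) ^ 2) ≤
        condensateOccupation N L (hφ.trialState hL hbL hν).ψ)
    (hJE : ∀ (v : ℝ → ENNReal), Measurable v →
      ∀ (N : ℕ) (L b : ℝ) (φ : Space → ℝ) (hφ : IsPairProfile b φ) (hL : 0 < L) (hbL : 2 * b < L)
        (hν : 0 < jastrowNormR L φ (Finset.univ : Finset (Fin N))) (E I K : ℝ),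
        2 ≤ N → 0 < b → 0 ≤ E → 0 ≤ I → 0 ≤ K →
        profileEnergy v φ ≤ ENNReal.ofReal E → profileDefect φ ≤ ENNReal.ofReal I →
        profileK φ ≤ ENNReal.ofReal K → ((N : ℝ) - 1) * I < L ^ 3 →
        periodicEnergy v (hφ.trialState hL hbL hν) ≤ ENNReal.ofReal
          (N * ((N : ℝ) - 1) / 2 * E / (L ^ 3 - ((N : ℝ) - 1) * I) +
            N * ((N : ℝ) - 1) * ((N : ℝ) - 2) * K ^ 2 / (L ^ 3 - ((N : ℝ) - 1) * I) ^ 2))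
    {v : ℝ → ℝ≥0∞} (hv : Measurable v) (hv0 : ∀ᵐ x : Space, v ‖x‖ = 0)
    (ha0 : scatteringLength v = 0) (η ρ : ℝ) {N : ℕ} (hN : 2 ≤ N) {L : ℝ} (hL : 0 < L) :
    ∃ Φ : PeriodicTrialState N L,
      periodicEnergy v Φ ≤
          ENNReal.ofReal (4 * Real.pi * (scatteringLength v).toReal * ρ * (1 + η) * (N : ℝ)) ∧
        (N : ℝ≥0∞) ≤ condensateOccupation N L Φ.ψ + ENNReal.ofReal (η * (N : ℝ)) := by
  have hβ : 0 < L / 4 := by positivity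
  have hβL : 2 * (L / 4) < L := by linarith
  have hI : ((N : ℝ) - 1) * 0 < L ^ 3 := by rw [mul_zero]; positivity
  have hν : 0 < jastrowNormR L (fun _ => (1 : ℝ)) (Finset.univ : Finset (Fin N)) :=
    (isPairProfile_one (L / 4)).jastrowNormR_pos hL hβL le_rfl (by simp) hI _
  refine ⟨(isPairProfile_one (L / 4)).trialState hL hβL hν, ?_, ?_⟩
  · have h := hJE v hv N L (L / 4) (fun _ => 1) (isPairProfile_one _) hL hβL hν 0 0 0 hN hβ
      le_rfl le_rfl le_rfl (by rw [profileEnergy_one_eq_zero hv0]; exact bot_le) (by simp)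
      (by simp) hI
    refine h.trans ?_
    simp [ha0]
  · have h := hJD N L (L / 4) (fun _ => 1) (isPairProfile_one _) hL hβL hν 0 le_rfl (by simp)
      hI.le
    simp only [mul_zero, zero_div, sub_zero, one_pow, ENNReal.ofReal_one, mul_one] at h
    exact le_add_right h

/-- The case `a > 0`, at fixed `N ≥ 2` and `L` with `N/L³ = ρ`: with the profile of App. C at
cut-off `b/4`, `b = (4πρ₁/3)^{-1/3}`, `ρ₁ = (N-1)/L³`, and `ρ` so small that
`4πρa³ ≤ 3 min(1/16, η/30)³` (i.e. `x = a/b ≤ min(1/16, η/30)`) and `256πρb₀³ ≤ 3` (i.e.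
`b/4 ≥ b₀`), the Jastrow state has energy `≤ 4πaρ(1+η)N` and condensate `≥ N - ηN`
(`(N-1)I = (3/4)xL³`). [cite: LSSY2005, Thm. 2.2, proof, (2.26)–(2.33); App. C (C.8)] -/
theorem condensedTrialState_of_pos
    (hJD : ∀ (N : ℕ) (L b : ℝ) (φ : Space → ℝ) (hφ : IsPairProfile b φ) (hL : 0 < L)
      (hbL : 2 * b < L) (hν : 0 < jastrowNormR L φ (Finset.univ : Finset (Fin N))) (I : ℝ),
      0 ≤ I → profileDefect φ ≤ ENNReal.ofReal I → ((N : ℝ) - 1) * I ≤ L ^ 3 →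
      (N : ENNReal) * ENNReal.ofReal ((1 - ((N : ℝ) - 1) * I / L ^ 3) ^ 2) ≤
        condensateOccupation N L (hφ.trialState hL hbL hν).ψ)
    (hJE : ∀ (v : ℝ → ENNReal), Measurable v →
      ∀ (N : ℕ) (L b : ℝ) (φ : Space → ℝ) (hφ : IsPairProfile b φ) (hL : 0 < L) (hbL : 2 * b < L)
        (hν : 0 < jastrowNormR L φ (Finset.univ : Finset (Fin N))) (E I K : ℝ),
        2 ≤ N → 0 < b → 0 ≤ E → 0 ≤ I → 0 ≤ K →
        profileEnergy v φ ≤ ENNReal.ofReal E → profileDefect φ ≤ ENNReal.ofReal I →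
        profileK φ ≤ ENNReal.ofReal K → ((N : ℝ) - 1) * I < L ^ 3 →
        periodicEnergy v (hφ.trialState hL hbL hν) ≤ ENNReal.ofReal
          (N * ((N : ℝ) - 1) / 2 * E / (L ^ 3 - ((N : ℝ) - 1) * I) +
            N * ((N : ℝ) - 1) * ((N : ℝ) - 2) * K ^ 2 / (L ^ 3 - ((N : ℝ) - 1) * I) ^ 2))
    {v : ℝ → ℝ≥0∞} (hv : Measurable v) (ha : 0 < (scatteringLength v).toReal)
    {b₀ : ℝ} (hab₀ : (scatteringLength v).toReal < b₀)
    (hA : ∀ (b ε : ℝ), b₀ ≤ b → 0 < ε →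
      ∃ φ : Space → ℝ, IsPairProfile b φ ∧
        profileEnergy v φ ≤ ENNReal.ofReal
          (8 * Real.pi * (scatteringLength v).toReal / (1 - (scatteringLength v).toReal / b) + ε) ∧
        profileDefect φ ≤ ENNReal.ofReal (16 * Real.pi * (scatteringLength v).toReal * b ^ 2) ∧
        profileK φ ≤ ENNReal.ofReal (16 * Real.pi * (scatteringLength v).toReal * b))
    {η ρ : ℝ} (hη : 0 < η) (hρ : 0 < ρ)
    (hρc : 4 * Real.pi * ρ * (scatteringLength v).toReal ^ 3 ≤ 3 * min (1 / 16) (η / 30) ^ 3)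
    (hρb : 256 * Real.pi * ρ * b₀ ^ 3 ≤ 3)
    {N : ℕ} (hN : 2 ≤ N) {L : ℝ} (hL : 0 < L) (hL3 : (N : ℝ) / L ^ 3 = ρ) :
    ∃ Φ : PeriodicTrialState N L,
      periodicEnergy v Φ ≤
          ENNReal.ofReal (4 * Real.pi * (scatteringLength v).toReal * ρ * (1 + η) * (N : ℝ)) ∧
        (N : ℝ≥0∞) ≤ condensateOccupation N L Φ.ψ + ENNReal.ofReal (η * (N : ℝ)) := by
  set a := (scatteringLength v).toReal
  set c : ℝ := min (1 / 16) (η / 30)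
  have hc0 : 0 < c := lt_min (by norm_num) (by positivity)
  have hc16 : c ≤ 1 / 16 := min_le_left _ _
  have hc30 : c ≤ η / 30 := min_le_right _ _
  have hb₀ : 0 < b₀ := ha.trans hab₀
  have hπ := Real.pi_pos
  have hN' : (2 : ℝ) ≤ N := by exact_mod_cast hN
  have hn₁ : (1 : ℝ) ≤ (N : ℝ) - 1 := by linarith
  have hL30 : 0 < L ^ 3 := by positivity
  -- the parameters `b = (4πρ₁/3)^{-1/3}`, `ρ₁ = (N-1)/L³ ≤ ρ`
  set b : ℝ := (4 * Real.pi * (((N : ℝ) - 1) / L ^ 3) / 3) ^ (-(1 : ℝ) / 3) with hb_def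
  have ht : 0 < 4 * Real.pi * (((N : ℝ) - 1) / L ^ 3) / 3 := by positivity
  have hb0 : 0 < b := Real.rpow_pos_of_pos ht _
  have hb3 : 4 * Real.pi * ((N : ℝ) - 1) * b ^ 3 = 3 * L ^ 3 := by
    have h3 : b ^ 3 = (4 * Real.pi * (((N : ℝ) - 1) / L ^ 3) / 3)⁻¹ := by
      rw [hb_def, ← Real.rpow_natCast, ← Real.rpow_mul ht.le]
      norm_num
      rw [Real.rpow_neg_one, inv_div]
    rw [h3]
    field_simp
  have hρ₁ : ((N : ℝ) - 1) / L ^ 3 ≤ ρ := by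
    rw [← hL3]
    gcongr
    linarith
  -- `4πρb³ ≥ 3`
  have hb3ge : 3 ≤ 4 * Real.pi * ρ * b ^ 3 := by
    have h1 : (N : ℝ) - 1 ≤ ρ * L ^ 3 := (div_le_iff₀ hL30).mp hρ₁
    have h2 : 3 * L ^ 3 ≤ 4 * Real.pi * ρ * b ^ 3 * L ^ 3 := by
      calc 3 * L ^ 3 = 4 * Real.pi * ((N : ℝ) - 1) * b ^ 3 := hb3.symm
        _ ≤ 4 * Real.pi * (ρ * L ^ 3) * b ^ 3 := by gcongr
        _ = 4 * Real.pi * ρ * b ^ 3 * L ^ 3 := by ring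
    exact le_of_mul_le_mul_right h2 hL30
  -- `x = a/b ≤ c ≤ min(1/16, η/30)`
  have hab : a ≤ c * b := by
    refine le_of_pow_le_pow_left₀ (by norm_num : (3 : ℕ) ≠ 0) (by positivity) ?_
    have h : 4 * Real.pi * ρ * a ^ 3 ≤ 4 * Real.pi * ρ * (c * b) ^ 3 := by
      calc 4 * Real.pi * ρ * a ^ 3 ≤ 3 * c ^ 3 := hρc
        _ ≤ 4 * Real.pi * ρ * b ^ 3 * c ^ 3 :=
            mul_le_mul_of_nonneg_right hb3ge (pow_pos hc0 3).le
        _ = 4 * Real.pi * ρ * (c * b) ^ 3 := by ring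
    exact le_of_mul_le_mul_left h (by positivity)
  have hx : a / b ≤ c := by rwa [div_le_iff₀ hb0]
  have hx16 : a / b ≤ 1 / 16 := hx.trans hc16
  have hxη : 12 * (a / b) ≤ η / 2 := by linarith
  -- `b/4 ≥ b₀ > a`
  have hb4 : b₀ ≤ b / 4 := by
    have h4b : 4 * b₀ ≤ b := by
      refine le_of_pow_le_pow_left₀ (by norm_num : (3 : ℕ) ≠ 0) hb0.le ?_
      have h : 4 * Real.pi * ρ * (4 * b₀) ^ 3 ≤ 4 * Real.pi * ρ * b ^ 3 := by
        calc 4 * Real.pi * ρ * (4 * b₀) ^ 3 = 256 * Real.pi * ρ * b₀ ^ 3 := by ring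
          _ ≤ 3 := hρb
          _ ≤ 4 * Real.pi * ρ * b ^ 3 := hb3ge
      exact le_of_mul_le_mul_left h (by positivity)
    linarith
  have hβ : 0 < b / 4 := by positivity
  have haβ : a < b / 4 := hab₀.trans_le hb4
  -- `2 (b/4) < L`
  have hbL : b < L := by
    refine lt_of_pow_lt_pow_left₀ 3 hL.le ?_
    have hb3' : 0 < b ^ 3 := by positivity
    have h1 : b ^ 3 ≤ ((N : ℝ) - 1) * b ^ 3 := le_mul_of_one_le_left hb3'.le hn₁
    have h2 : 4 * Real.pi * b ^ 3 ≤ 4 * Real.pi * (((N : ℝ) - 1) * b ^ 3) :=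
      mul_le_mul_of_nonneg_left h1 (by positivity)
    have h3 : 4 * 2 * b ^ 3 ≤ 4 * Real.pi * b ^ 3 := by
      have := Real.two_le_pi
      gcongr
    nlinarith
  have hβL : 2 * (b / 4) < L := by linarith
  -- the profile at cut-off `b/4` with slack `ε'`, and its Jastrow state
  have hD : 0 < L ^ 3 - ((N : ℝ) - 1) * (16 * Real.pi * a * (b / 4) ^ 2) := by
    have hNI : ((N : ℝ) - 1) * (16 * Real.pi * a * (b / 4) ^ 2) =
        4 * Real.pi * ((N : ℝ) - 1) * b ^ 3 * (a / b) / 4 := by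
      field_simp
      ring
    rw [hNI, hb3]
    nlinarith
  set ε' : ℝ := 8 * Real.pi * a * ρ * (η / 2) * (L ^ 3 - ((N : ℝ) - 1) *
    (16 * Real.pi * a * (b / 4) ^ 2)) / ((N : ℝ) - 1) with hε'_def
  have hε' : 0 < ε' := by positivity
  obtain ⟨φ, hφ, hφE, hφI, hφK⟩ := hA (b / 4) ε' hb4 hε'
  set I₀ : ℝ := 16 * Real.pi * a * (b / 4) ^ 2 with hI₀_def
  have hI₀ : 0 ≤ I₀ := by positivity
  have hNI : ((N : ℝ) - 1) * I₀ = 3 * (a / b) / 4 * L ^ 3 := by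
    have h' : ((N : ℝ) - 1) * I₀ = 4 * Real.pi * ((N : ℝ) - 1) * b ^ 3 * (a / b) / 4 := by
      rw [hI₀_def]
      field_simp
      ring
    rw [h', hb3]
    ring
  have hIlt : ((N : ℝ) - 1) * I₀ < L ^ 3 := by
    rw [hNI]
    have h1 : 3 * (a / b) / 4 < 1 := by linarith
    exact (mul_lt_iff_lt_one_left hL30).mpr h1
  have ht₀ : ((N : ℝ) - 1) * I₀ / L ^ 3 = 3 * (a / b) / 4 := by
    rw [hNI, mul_div_assoc, div_self hL30.ne', mul_one]
  have hν : 0 < jastrowNormR L φ (Finset.univ : Finset (Fin N)) :=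
    hφ.jastrowNormR_pos hL hβL hI₀ hφI hIlt _
  refine ⟨hφ.trialState hL hβL hν, ?_, ?_⟩
  · -- the energy
    have hE : 0 ≤ 8 * Real.pi * a / (1 - a / (b / 4)) + ε' := by
      have h1 : a / (b / 4) < 1 := (div_lt_one hβ).mpr haβ
      have h2 : 0 ≤ 8 * Real.pi * a / (1 - a / (b / 4)) := div_nonneg (by positivity) (by linarith)
      linarith
    have hK : 0 ≤ 16 * Real.pi * a * (b / 4) := by positivity
    have hN1 : (N : ℝ) - 1 ≠ 0 := by positivity
    have hD' : L ^ 3 - ((N : ℝ) - 1) * I₀ ≠ 0 := hD.ne'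
    have hslack : N * ((N : ℝ) - 1) / 2 * ε' / (L ^ 3 - ((N : ℝ) - 1) * I₀) =
        4 * Real.pi * a * ρ * (η / 2) * N := by
      rw [hε'_def]
      field_simp [hD', hN1]
      ring
    have h := hJE v hv N L (b / 4) φ hφ hL hβL hν _ I₀ _ hN hβ hE hI₀ hK hφE hφI hφK hIlt
    refine h.trans (ENNReal.ofReal_le_ofReal ?_)
    exact condensedTrialState_energy_le hN' ha hb0 hx16 hxη hb3 hρ.le hρ₁ hslack.le
  · -- the depletion
    have h := hJD N L (b / 4) φ hφ hL hβL hν I₀ hI₀ hφI hIlt.le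
    rw [ht₀] at h
    refine condensedTrialState_natCast_le ?_ h
    linarith

/-- **Stub B1c of the line `registered` of the crux `BeliaevDeformationBound`: a condensed
near-optimal periodic trial state.** Granting the depletion bound `n₀(Ψ_J) ≥ N(1 - (N-1)I/L³)²`
(B1a) and the energy bound `⟨Ψ_J, HΨ_J⟩ ≤ N(N-1)/2 · E/(L³-(N-1)I) + N(N-1)(N-2)K²/(L³-(N-1)I)²`
(B1b) of the Jastrow state of a pair profile, for every soft repulsive finite-range `v` and every
`η > 0` there is `ρ₀ > 0` such that for `0 < ρ < ρ₀` and every `N = n + 2` the torus of side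
`(N/ρ)^{1/3}` carries a periodic trial state of energy `≤ 4πaρ(1+η)N` with `n₀ ≥ N - ηN`: the
parameter choice (2.32)–(2.33) of the Dyson–LSSY upper bound (`b = (4πρ₁/3)^{-1/3}`, cut-off `b/4`,
`x = a/b ≤ min(1/16, η/30)`), resp. the constant profile when `a = 0`.
[cite: LSSY2005, Thm. 2.2, proof, (2.32)–(2.33)] -/
theorem stub_condensedTrialState :
  (∀ (N : ℕ) (L b : ℝ) (φ : Space → ℝ) (hφ : IsPairProfile b φ) (hL : 0 < L) (hbL : 2 * b < L)
    (hν : 0 < jastrowNormR L φ (Finset.univ : Finset (Fin N))) (I : ℝ),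
    0 ≤ I → profileDefect φ ≤ ENNReal.ofReal I → ((N : ℝ) - 1) * I ≤ L ^ 3 →
    (N : ENNReal) * ENNReal.ofReal ((1 - ((N : ℝ) - 1) * I / L ^ 3) ^ 2) ≤
      condensateOccupation N L (hφ.trialState hL hbL hν).ψ) →
  (∀ (v : ℝ → ENNReal), Measurable v →
    ∀ (N : ℕ) (L b : ℝ) (φ : Space → ℝ) (hφ : IsPairProfile b φ) (hL : 0 < L) (hbL : 2 * b < L)
      (hν : 0 < jastrowNormR L φ (Finset.univ : Finset (Fin N))) (E I K : ℝ),
      2 ≤ N → 0 < b → 0 ≤ E → 0 ≤ I → 0 ≤ K →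
      profileEnergy v φ ≤ ENNReal.ofReal E → profileDefect φ ≤ ENNReal.ofReal I →
      profileK φ ≤ ENNReal.ofReal K → ((N : ℝ) - 1) * I < L ^ 3 →
      periodicEnergy v (hφ.trialState hL hbL hν) ≤ ENNReal.ofReal
        (N * ((N : ℝ) - 1) / 2 * E / (L ^ 3 - ((N : ℝ) - 1) * I) +
          N * ((N : ℝ) - 1) * ((N : ℝ) - 2) * K ^ 2 / (L ^ 3 - ((N : ℝ) - 1) * I) ^ 2)) →
  ∀ (v : ℝ → ENNReal), IsRepulsiveFiniteRange v → (∫⁻ x : Space, v ‖x‖) ≠ ⊤ → ∀ η : ℝ, 0 < η →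
    ∃ ρ₀ : ℝ, 0 < ρ₀ ∧ ∀ ρ : ℝ, 0 < ρ → ρ < ρ₀ → ∀ᶠ n : ℕ in Filter.atTop,
      ∃ Φ : PeriodicTrialState (n + 2) (sideLength ρ (n + 2)),
        periodicEnergy v Φ ≤
            ENNReal.ofReal (4 * Real.pi * (scatteringLength v).toReal * ρ * (1 + η) * ((n + 2 : ℕ) : ℝ)) ∧
          ((n + 2 : ℕ) : ENNReal) ≤ condensateOccupation (n + 2) (sideLength ρ (n + 2)) Φ.ψ +
            ENNReal.ofReal (η * ((n + 2 : ℕ) : ℝ)) := by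
  intro hJD hJE v hv hint η hη
  obtain ⟨R₀, hR⟩ := hv.2
  rcases eq_or_ne (scatteringLength v) 0 with ha0 | ha0
  · -- `a = 0`: `v = 0` a.e. and the constant profile does it, at every `ρ` and `N`
    have hv0 : ∀ᵐ x : Space, v ‖x‖ = 0 := LSSY2005_zeroScatteringLength_holds v R₀ hv.1 hR ha0
    refine ⟨1, one_pos, fun ρ hρ _ => Filter.Eventually.of_forall fun n => ?_⟩
    exact condensedTrialState_of_zero hJD hJE hv.1 hv0 ha0 η ρ (by omega)
      (by unfold sideLength; exact Real.rpow_pos_of_pos (div_pos (by positivity) hρ) _)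
  · -- `a > 0`: the profile of App. C, for `ρ < ρ₀(v, η)` and every `N`
    have hmeas : Measurable fun x : Space => v ‖x‖ := hv.1.comp measurable_norm
    have haT : scatteringLength v ≠ ⊤ := by
      refine scatteringLength_ne_top ?_
      rw [lintegral_const_mul _ hmeas]
      exact ENNReal.mul_ne_top (by simp) hint
    have ha : 0 < (scatteringLength v).toReal := ENNReal.toReal_pos ha0 haT
    obtain ⟨b₀, hab₀, hA⟩ :=
      LSSY2005_dysonProfile_holds v R₀ hv.1 hR haT (pos_iff_ne_zero.mpr ha0)
    have hb₀ : 0 < b₀ := ha.trans hab₀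
    have hπ := Real.pi_pos
    have hc0 : 0 < min (1 / 16 : ℝ) (η / 30) := lt_min (by norm_num) (by positivity)
    refine ⟨min (3 * min (1 / 16 : ℝ) (η / 30) ^ 3 /
          (4 * Real.pi * (scatteringLength v).toReal ^ 3)) (3 / (256 * Real.pi * b₀ ^ 3)),
      lt_min (by positivity) (by positivity),
      fun ρ hρ hρlt => Filter.Eventually.of_forall fun n => ?_⟩
    have h1 := (lt_div_iff₀ (by positivity)).mp (hρlt.trans_le (min_le_left _ _))
    have h2 := (lt_div_iff₀ (by positivity)).mp (hρlt.trans_le (min_le_right _ _))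
    exact condensedTrialState_of_pos hJD hJE hv.1 ha hab₀ hA hη hρ (by linarith) (by linarith)
      (by omega) (by unfold sideLength; exact Real.rpow_pos_of_pos (div_pos (by positivity) hρ) _) (div_sideLength_pow_three hρ (by omega))

end Summit.AtomisticToContinuum.BoseEinsteinCondensation.Theorems.BeliaevDeformationBound

end
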